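import Summits.AtomisticToContinuum.HydrodynamicLimit.Theorems.OneFlightGossipEngineEnergyCurrentTailsFirstPartnerRung0
import HarnessLib

/-!
# Crux `EnergyCurrentTails` (stmt-AtomisticToContinuum-9235), line `quartic-schur-ledger`:
# S6 `shareRung0_floorWindow` of the RUNG-0 certificate of I′ `FirstPartnerRealisedShare`

The static first-partner floor up to the out-degree-≥-2 excess, for GENERAL thresholds `K₀`, `K₁ ≥ 0`, `K₂ ≥ 0`
and an explicit look-ahead `Δ = κ ε_N`: the public general-threshold twin of the private `rung0_floor_window` of
`…Theorems.OneFlightGossipEngineEnergyCurrentTailsFirstPartnerRung0` (there `K₀ = K₁ = 1`, `K₂ = 3`).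

For constant profiles `(a, u, θ)` the homogeneous drifted Gibbs law `G_N` is invariant under every hard-sphere flow
(`lintegral_comp_flow_localGibbsLaw_const`).  With the band mixing mark
`Ξ_K(m, v, w) = [K₀ < ‖v‖ ≤ K₂] [‖w‖ ≤ K₁] · 2 ‖v′‖² ‖w′‖²` (measurable, `0 ≤ Ξ_K ≤ (K₂² + K₁²)²/2` by energy
conservation of the reflection, `Ξ_K = 0` once `‖v − w‖ ≥ K₁ + K₂ + 1`):
H3 `EnergyCurrentTailsLevelCensus.sum_pair_tubeMark_mean_ge_of_measurable` (static tube mean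
`≥ (N+1) N (1 − 16λ) ε³ κ Θ̄`) = tube mean along `Φ_r` (invariance; a.e. orbit is good, hence in the hard-sphere
domain) `≤` H1 `firstPartnerRung0_pathwise` integrated (`(N+1) · E[firstPartnerSum] + (K₂²+K₁²)²/2 · #{out-degree ≥ 2}`)
with the excess count controlled by H2 `firstPartnerRung0_excess` at `h = κ ε`.

References: Gallagher–Saint-Raymond–Texier 2013 §4.1; Ruelle 1969 §4.2; Cercignani–Illner–Pulvirenti 1994 §2.2.
-/

noncomputable section

open scoped BigOperators Classical ENNReal InnerProductSpace
open MeasureTheory Set Filter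
open Literature.Analysis.FluidPDE Literature.MathematicalPhysics.KineticTheory
  Literature.MathematicalPhysics.StatisticalMechanics

namespace Summit.AtomisticToContinuum.HydrodynamicLimit.Theorems

namespace QuarticSchurLedger

open EnergyCurrentTailsFirstPartner RateFloorLine

-- adapted from `ofReal_le_of_le_add_mul_card` of `…Theorems.OneFlightGossipEngineEnergyCurrentTailsFirstPartnerRung0`
/-- `t ≤ n f + C k` and `k ≤ M` give `ofReal t ≤ n · ofReal f + ofReal C · M` in `ℝ≥0∞` (`C ≥ 0`). [folklore] -/
private theorem ofReal_le_natMul_add_ofReal_mul {t f C : ℝ} {n k : ℕ} {M : ℝ≥0∞} (hC : 0 ≤ C)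
    (h : t ≤ (n : ℝ) * f + C * (k : ℝ)) (hk : (k : ℝ≥0∞) ≤ M) :
    ENNReal.ofReal t ≤ (n : ℝ≥0∞) * ENNReal.ofReal f + ENNReal.ofReal C * M :=
  calc ENNReal.ofReal t ≤ ENNReal.ofReal ((n : ℝ) * f + C * (k : ℝ)) := ENNReal.ofReal_le_ofReal h
    _ ≤ ENNReal.ofReal ((n : ℝ) * f) + ENNReal.ofReal (C * (k : ℝ)) := ENNReal.ofReal_add_le
    _ = (n : ℝ≥0∞) * ENNReal.ofReal f + ENNReal.ofReal C * (k : ℝ≥0∞) := by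
        rw [ENNReal.ofReal_mul (Nat.cast_nonneg _), ENNReal.ofReal_natCast, ENNReal.ofReal_mul hC,
          ENNReal.ofReal_natCast]
    _ ≤ _ := add_le_add le_rfl (mul_le_mul_right hk _)

/-- **S6 · the static first-partner floor up to the out-degree-≥-2 excess, general thresholds, explicit look-ahead
`Δ = κ ε_N`.**  For constant profiles, small density, a flow `Φ`, a time `r`, thresholds `K₀`, `K₁ ≥ 0`, `K₂ ≥ 0`,
a look-ahead ratio `κ > 0` with `κ ε_N = Δ` and the chart hypothesis `ε_N (1 + 2κ(K₁ + K₂ + 1)) < 1/2`: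
`(N+1) N (1 − 16λ) ε_N³ κ Θ̄_K ≤ (N+1) · E_{G_N}[firstPartnerSum(Δ, mixMark N K₀ K₁) ∘ Φ_r]
  + (K₂²+K₁²)²/2 · 4096 (N+1)³ ε_N⁴ (κε_N)² (‖u‖² + 3θ)`
(H3 ≤ static tube mean = tube mean along `Φ_r` by invariance ≤ H1 integrated, the excess by H2); public
general-threshold twin of `rung0_floor_window`. [folklore] -/
theorem shareRung0_floorWindow : ∀ (σ : ℝ), 0 < σ → SmallDensity uniformProfile σ → ∀ (a θb : ℝ), 0 < a → 0 < θb → ∀ (u : V3) (N : ℕ) (Φ : HardSphereFlow (Torus.geometry (Fin 3)) (hsDiameter σ N) (N + 1)) (r K₀ K₁ K₂ κ Δ : ℝ), 0 ≤ K₁ → 0 ≤ K₂ → 0 < κ → κ * hsDiameter σ N = Δ → hsDiameter σ N * (1 + 2 * κ * (K₁ + K₂ + 1)) < 1 / 2 → ENNReal.ofReal (((N + 1 : ℕ) : ℝ) * N * ((1 - 16 * ovDensity uniformProfile σ) * hsDiameter σ N ^ 3 * κ * ∫ p : V3 × V3, sphereMark (fun q : V3 × V3 × V3 => if K₀ < ‖q.2.1‖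 ∧ ‖q.2.1‖ ≤ K₂ ∧ ‖q.2.2‖ ≤ K₁ then 2 * (‖(reflectVel q.1 (q.2.1, q.2.2)).1‖ ^ 2 * ‖(reflectVel q.1 (q.2.1, q.2.2)).2‖ ^ 2) else 0) p.1 p.2 * (localMaxwellian 1 θb u p.1 * localMaxwellian 1 θb u p.2))) ≤ ((N + 1 : ℕ) : ℝ≥0∞) * (∫⁻ z, ENNReal.ofReal (firstPartnerSum (hsDiameter σ N) Δ (Φ.flow r z) r (mixMark N K₀ K₁)) ∂(localGibbsLaw σ (fun _ => a) (fun _ => u) (fun _ => θb) N Φ)) + ENNReal.ofReal ((K₂ ^ 2 + K₁ ^ 2) ^ 2 / 2 * (4096 * (((N + 1 : ℕ) : ℝ) ^ 3 * (hsDiameter σ N ^ 4 * (κ * hsDiameter σ N) ^ 2 * (‖u‖ ^ 2 + 3 * θb))))) := by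
  intro σ hσ hsd a θb ha hθ u N Φ r K₀ K₁ K₂ κ Δ hK₁ hK₂ hκ hκε hchart
  have hσ2 : σ < 1 / 2 := hsd.σ_lt_half
  have hε : 0 < hsDiameter σ N := hsDiameter_pos hσ N
  -- the error constant `C = (K₂² + K₁²)²/2 ≥ 0` and the speed cutoff `L = (K₁ + K₂ + 1)/2`
  set C : ℝ := (K₂ ^ 2 + K₁ ^ 2) ^ 2 / 2 with hCdef
  have hC0 : 0 ≤ C := by positivity
  have hL0 : (0 : ℝ) ≤ (K₁ + K₂ + 1) / 2 := by positivity
  have hsmallT : hsDiameter σ N * (1 + 2 * ((K₁ + K₂ + 1) / 2) * κ) < 1 / 2 := by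
    have : hsDiameter σ N * (1 + 2 * ((K₁ + K₂ + 1) / 2) * κ) ≤ hsDiameter σ N * (1 + 2 * κ * (K₁ + K₂ + 1)) := by
      have hKp : 0 < K₁ + K₂ + 1 := by positivity
      nlinarith [mul_pos hε (mul_pos hκ hKp)]
    exact this.trans_lt hchart
  -- the band mixing mark `Ξ`: measurable, `0 ≤ Ξ ≤ C`, vanishing for `‖v − v′‖ ≥ K₁ + K₂ + 1`
  set Ξ : V3 × V3 × V3 → ℝ := fun q : V3 × V3 × V3 => if K₀ < ‖q.2.1‖ ∧ ‖q.2.1‖ ≤ K₂ ∧ ‖q.2.2‖ ≤ K₁ then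
    2 * (‖(reflectVel q.1 (q.2.1, q.2.2)).1‖ ^ 2 * ‖(reflectVel q.1 (q.2.1, q.2.2)).2‖ ^ 2) else 0 with hΞdef
  have hΞm : Measurable Ξ := by
    refine Measurable.ite ?_ ?_ measurable_const
    · have h1 : Measurable fun q : V3 × V3 × V3 => ‖q.2.1‖ := by fun_prop
      have h2 : Measurable fun q : V3 × V3 × V3 => ‖q.2.2‖ := by fun_prop
      exact (measurableSet_lt measurable_const h1).inter
        ((measurableSet_le h1 measurable_const).inter (measurableSet_le h2 measurable_const))
    · simp only [reflectVel]
      fun_prop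
  have hΞ0 : ∀ p, 0 ≤ Ξ p := fun p => by
    simp only [hΞdef]
    split_ifs
    · positivity
    · exact le_rfl
  have hΞC : ∀ p, Ξ p ≤ C := fun p => by
    simp only [hΞdef]
    split_ifs with h
    · -- energy conservation of the reflection: `2‖v′‖²‖w′‖² ≤ (‖v‖² + ‖w‖²)²/2 ≤ (K₂² + K₁²)²/2`
      obtain ⟨-, h2, h3⟩ := h
      have hv2 : ‖p.2.1‖ ^ 2 ≤ K₂ ^ 2 := pow_le_pow_left₀ (norm_nonneg _) h2 2
      have hw2 : ‖p.2.2‖ ^ 2 ≤ K₁ ^ 2 := pow_le_pow_left₀ (norm_nonneg _) h3 2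
      have hE : (‖p.2.1‖ ^ 2 + ‖p.2.2‖ ^ 2) ^ 2 / 2 ≤ C := by
        rw [hCdef]
        gcongr (?_) ^ 2 / 2
        exact add_le_add hv2 hw2
      exact (two_mul_reflect_sq_mul_sq_le p.1 p.2.1 p.2.2).trans hE
    · exact hC0
  have hΞabs : ∀ p, |Ξ p| ≤ C := fun p => by rw [abs_of_nonneg (hΞ0 p)]; exact hΞC p
  have hΞL : ∀ m v v' : V3, 2 * ((K₁ + K₂ + 1) / 2 : ℝ) ≤ ‖v - v'‖ → Ξ (m, v, v') = 0 := fun m v v' h => by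
    simp only [hΞdef]
    rw [if_neg]
    rintro ⟨-, h2, h3⟩
    have := norm_sub_le v v'
    linarith
  -- the law
  set G := localGibbsLaw σ (fun _ => a) (fun _ => u) (fun _ => θb) N Φ with hGdef
  haveI : IsProbabilityMeasure G := isProbabilityMeasure_localGibbsLaw continuous_const continuous_const
    continuous_const (fun _ => ha) (fun _ => hθ) hσ2.le N Φ
  -- the static tube sum and its measurability / integrability
  set tube : Config (N + 1) (Fin 3) T3 → ℝ := fun w => ∑ i : Fin (N + 1), ∑ j : Fin (N + 1),
    (if i ≠ j then pairTubeMark (hsDiameter σ N) κ Ξ i j (fun m => (w m).1) (fun m => (w m).2) else 0) with htube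
  have htubem : Measurable tube := by
    refine Finset.measurable_sum _ fun i _ => Finset.measurable_sum _ fun j _ => ?_
    by_cases hij : i ≠ j
    · simp only [if_pos hij]; exact measurable_pairTubeMark_config (hsDiameter σ N) κ hΞm i j
    · simp only [if_neg hij]; exact measurable_const
  have hptm0 : ∀ (i j : Fin (N + 1)) (x : Fin (N + 1) → T3) (v : Fin (N + 1) → V3),
      0 ≤ pairTubeMark (hsDiameter σ N) κ Ξ i j x v := fun i j x v => by
    unfold pairTubeMark tubeMark; split_ifs <;> [exact hΞ0 _; exact le_rfl]
  have htube0 : ∀ w, 0 ≤ tube w := fun w => Finset.sum_nonneg fun i _ => Finset.sum_nonneg fun j _ => by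
    split_ifs <;> [exact hptm0 _ _ _ _; exact le_rfl]
  have htubeb : ∀ w, ‖tube w‖ ≤ ((N + 1 : ℕ) : ℝ) * (((N + 1 : ℕ) : ℝ) * C) := fun w => by
    rw [Real.norm_eq_abs, abs_of_nonneg (htube0 w), htube]
    calc (∑ i : Fin (N + 1), ∑ j : Fin (N + 1),
          (if i ≠ j then pairTubeMark (hsDiameter σ N) κ Ξ i j (fun m => (w m).1) (fun m => (w m).2) else 0))
        ≤ ∑ _i : Fin (N + 1), ∑ _j : Fin (N + 1), C :=
          Finset.sum_le_sum fun i _ => Finset.sum_le_sum fun j _ => by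
            split_ifs <;> [exact (le_abs_self _).trans (abs_pairTubeMark_le _ _ hΞabs i j _ _); exact hC0]
      _ = ((N + 1 : ℕ) : ℝ) * (((N + 1 : ℕ) : ℝ) * C) := by
          simp only [Finset.sum_const, Finset.card_univ, Fintype.card_fin, nsmul_eq_mul]
  have htubei : Integrable tube G := Integrable.of_bound htubem.aestronglyMeasurable _ (ae_of_all _ htubeb)
  -- H2: the measurable majorant of the out-degree-≥-2 count (look-ahead `κ ε = Δ`)
  obtain ⟨M, hMm, hMD, hMI⟩ := firstPartnerRung0_excess σ hσ hσ2.le hsd a θb ha hθ u N Φ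
    (κ * hsDiameter σ N) (mul_pos hκ hε)
  have hMf : Measurable fun z => M (Φ.flow r z) := hMm.comp (Φ.measurable_flow r)
  -- H1 along `Φ_r`, a.e. (a.e. orbit is good, hence in the hard-sphere domain)
  have hae : ∀ᵐ z ∂G, ENNReal.ofReal (tube (Φ.flow r z)) ≤
      ((N + 1 : ℕ) : ℝ≥0∞) * ENNReal.ofReal (firstPartnerSum (hsDiameter σ N) Δ (Φ.flow r z) r (mixMark N K₀ K₁)) +
        ENNReal.ofReal C * M (Φ.flow r z) := by
    filter_upwards [ae_mem_good_localGibbsLaw σ (fun _ => a) (fun _ => u) (fun _ => θb) N Φ] with z hz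
    have hP := firstPartnerRung0_pathwise N (hsDiameter σ N) κ Δ K₀ K₁ K₂ r hε hκ.le hκε.le hK₁ hK₂ hchart
      (Φ.flow r z)
    exact ofReal_le_natMul_add_ofReal_mul hC0 hP (hMD _ (Φ.good_subset (Φ.mapsTo_good r hz)))
  -- H3: the tube mean (χ ≡ 1)
  have hT := EnergyCurrentTailsLevelCensus.sum_pair_tubeMark_mean_ge_of_measurable (u := u) Φ hsd ha hθ
    (χ := fun _ => (1 : ℝ)) continuous_const (fun _ => zero_le_one) hΞm hΞabs hΞ0 (L := (K₁ + K₂ + 1) / 2)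
    (κ := κ) hL0 hκ.le hΞL hsmallT
  simp only [one_mul, integral_const, smul_eq_mul, mul_one, probReal_univ] at hT
  have hmain : ((N + 1 : ℕ) : ℝ) * N * ((1 - 16 * ovDensity uniformProfile σ) * hsDiameter σ N ^ 3 * κ *
      ∫ p : V3 × V3, sphereMark Ξ p.1 p.2 * (localMaxwellian 1 θb u p.1 * localMaxwellian 1 θb u p.2)) ≤
      ∫ w, tube w ∂G := by
    simpa only [htube] using hT
  -- integrate along `Φ_r` and transport the measurable pieces back by invariance
  calc _ ≤ ENNReal.ofReal (∫ w, tube w ∂G) := ENNReal.ofReal_le_ofReal hmain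
    _ = ∫⁻ w, ENNReal.ofReal (tube w) ∂G := ofReal_integral_eq_lintegral_ofReal htubei (ae_of_all _ htube0)
    _ = ∫⁻ z, ENNReal.ofReal (tube (Φ.flow r z)) ∂G :=
        (lintegral_comp_flow_localGibbsLaw_const σ a θb u N Φ r (g := fun w => ENNReal.ofReal (tube w))
          htubem.ennreal_ofReal).symm
    _ ≤ ∫⁻ z, (((N + 1 : ℕ) : ℝ≥0∞) * ENNReal.ofReal (firstPartnerSum (hsDiameter σ N) Δ (Φ.flow r z) r
          (mixMark N K₀ K₁)) + ENNReal.ofReal C * M (Φ.flow r z)) ∂G := lintegral_mono_ae hae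
    _ = ((N + 1 : ℕ) : ℝ≥0∞) * (∫⁻ z, ENNReal.ofReal (firstPartnerSum (hsDiameter σ N) Δ (Φ.flow r z) r
          (mixMark N K₀ K₁)) ∂G) + ENNReal.ofReal C * ∫⁻ z, M (Φ.flow r z) ∂G := by
        rw [lintegral_add_right _ (hMf.const_mul _), lintegral_const_mul' _ _ (ENNReal.natCast_ne_top _),
          lintegral_const_mul _ hMf]
    _ = ((N + 1 : ℕ) : ℝ≥0∞) * (∫⁻ z, ENNReal.ofReal (firstPartnerSum (hsDiameter σ N) Δ (Φ.flow r z) r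
          (mixMark N K₀ K₁)) ∂G) + ENNReal.ofReal C * ∫⁻ w, M w ∂G := by
        rw [lintegral_comp_flow_localGibbsLaw_const σ a θb u N Φ r hMm]
    _ ≤ ((N + 1 : ℕ) : ℝ≥0∞) * (∫⁻ z, ENNReal.ofReal (firstPartnerSum (hsDiameter σ N) Δ (Φ.flow r z) r
          (mixMark N K₀ K₁)) ∂G) + ENNReal.ofReal C * ENNReal.ofReal (4096 * (((N + 1 : ℕ) : ℝ) ^ 3 *
            (hsDiameter σ N ^ 4 * (κ * hsDiameter σ N) ^ 2 * (‖u‖ ^ 2 + 3 * θb)))) := by gcongr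
    _ = _ := by rw [← ENNReal.ofReal_mul hC0]

end QuarticSchurLedger

end Summit.AtomisticToContinuum.HydrodynamicLimit.Theorems

end
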